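import Literature.ModelTheory.Zilber.EACAperiodicBase
import Literature.ModelTheory.Zilber.EACSubcellCertificates
import Literature.Combinatorics.Extremal.LinesThroughPointOfSurface
import HarnessLib

/-!
# Integer periods of irreducible plane curves are Mantova–Masser's lines of rational slope

Topic `Literature/ModelTheory/Zilber` — Zilber's Exponential-Algebraic-Closedness conjecture (EAC),
typed case ladder (lane pub-schanuel, seat 1). PROVED; a dictionary lemma between the typed notion
`HasIntegerPeriod` of `EACAperiodicBase` and the printed case distinction of Mantova–Masser 2024,
Thm. 1.2 (`n = 2`). No conjecture is asserted.

Mantova–Masser [MantovaMasser2023 = arXiv:2303.05592, §1 display (LRS) p. 3 and Thm. 1.2 p. 4] split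
the irreducible surfaces `S ⊆ ℂ² × (ℂ*)²` with `dim π(S) = 1` according to whether the Zariski closure
of `π(S)` — an irreducible plane curve — "is a line of rational slope", i.e. equals
`{m₁ X₁ + m₂ X₂ = c}` with `c ∈ ℂ` and integers `m₁, m₂` not both zero (LRS); by their Thm. 1.2 the
(LRS) case is the only one in which exponential points can fail to exist. In the typed ladder of
this topic the cells `ECCell (d + 1) d` are split instead by `HasIntegerPeriod ℂ (cl π(V))`
(sub-cells `ECCellAperiodic d` / `ECCellPeriodic d` of `EACAperiodicBase`), a notion that makes sense
for bases of any dimension. This file proves that for plane curves the two notions AGREE: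

* `hasIntegerPeriod_iff_isRationalSlopeLine` — for `S ⊆ F²` irreducible Zariski closed of dimension
  `1` over a field of characteristic `0`: `HasIntegerPeriod F S ↔ IsRationalSlopeLine S`;
* `hasIntegerPeriod_projAdd_iff_isRationalSlopeLine` — hence for irreducible `W ⊆ ℂ² × ℂ²` meeting
  `G²` with `dim cl π(W ∩ G²) = 1`, the base has an integer period iff its closure is a line of
  rational slope: the hypothesis singled out by `ECCellPeriodic 1` is exactly the (LRS) case of
  [MantovaMasser2023, Thm. 1.2], and `ECCellAperiodic 1` is its case "not a line of rational slope".

* `ecCellPeriodic_one`, `ecCell_two_one_iff_ecCellAperiodic_one` — in cell `(2, 1)` the periodic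
  sub-cell is VACUOUS: a line of rational slope `{m₁x₁ + m₂x₂ = c}` forces (AF) on `S`, so no
  additively free `S` has a periodic base, and `ECCell 2 1 ↔ ECCellAperiodic 1`; by contrast in cell
  `(3, 2)` all eight hypotheses of `ECCellPeriodic 2` are simultaneously satisfiable
  (`ecCellPeriodic_two_hypotheses_satisfiable`, the parabolic cylinder of `EACSubcellCertificates`) —
  the periodic sub-rung is a phenomenon that first appears at `n = 3`;
* `mantovaMasser2024_thm_1_2_notLRS` — Mantova–Masser 2024 Thm. 1.2, case "`dim π(S) = 1`, closure
  not a line of rational slope ⇒ `π(Z)` infinite", typed verbatim as a named fact (proved in print,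
  used only as a hypothesis), with `ecCellAperiodic_one_of_mantovaMasser_thm_1_2 : _ → ECCellAperiodic 1`;
* the (LRS) sub-cases of Thm. 1.2: Mantova–Masser's `G = L × exp(L)` (`lineTimesExpImage`) and
  `T = S ∩ G` (`mmT`); the first sub-case "`T = ∅ ⇒ π(Z) = ∅`" is PROVED
  (`mantovaMasser2024_thm_1_2_LRS_T_empty`, indeed `Z ⊆ T`), the three remaining sub-cases
  (`dim T = 2`; `dim T = 1, dim π(T) = 0`; `dim T = 1, dim π(T) = 1`) are typed verbatim as the named
  fact `mantovaMasser2024_thm_1_2_LRS`.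

In cell `(3, 2)` the periodic sub-cell `ECCellPeriodic 2` (cylinders over a rational direction,
`EACAperiodicBase`, Cylinder section) is thus the typed higher-dimensional analogue of (LRS), for
which no printed result exists (Mantova–Masser 2024 §1, "Further remarks").

Proof of `→`. By the cylinder lemma (`exists_forall_add_smul_mem_of_hasIntegerPeriod`) the closed
curve `S` contains, with each of its points `p`, the whole line `p + F·v` through an integer period
`v`; `I(S) = (h)` is principal with `h` irreducible (`exists_irreducible_vanishingIdeal_eq_span`,
`d = 1`); `h(X + p)` vanishes on the line `F·v = {v₂ z₁ - v₁ z₂ = 0}` through the origin, so the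
linear form `v₂ X₁ - v₁ X₂` divides `h(X + p)` (`Literature.Combinatorics.Extremal.X_zero_dvd_of_eval_eq_zero`
after a linear change of coordinates, verbatim the argument of
`Literature.Combinatorics.Extremal.linearForm_dvd_of_eval_eq_zero` for planes in `F³`); translating
back, the affine linear form `ℓ = v₂ (X₁ - p₁) - v₁ (X₂ - p₂)` divides `h`; as `h` is irreducible and
`ℓ` is not a unit, `h = ℓ·c` with `c ∈ Fˣ`, so `S = Z(h) = Z(ℓ) = {v₂ x₁ - v₁ x₂ = v₂ p₁ - v₁ p₂}`.
`←`: `(m₂, -m₁)` is an integer period of `{m₁ x₁ + m₂ x₂ = c}`. Elementary algebra throughout.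
[folklore]; the notion (LRS) and the case split are [cite: MantovaMasser2023, §1 (LRS), Thm. 1.2].
-/

noncomputable section

open MvPolynomial

universe u

namespace Literature.ModelTheory.Zilber

open Literature.NumberTheory.Transcendental
open Literature.Combinatorics.Extremal (X_zero_dvd_of_eval_eq_zero)
open Literature.Computability.AlgebraicComplexity.DeterminantalConormal (eval_linSubst
  linSubst_linSubst linSubst_one)

variable {F : Type u} [Field F]

/-! ### A linear form vanishing wherever a polynomial's zero line lies divides it (plane version) -/

section LinearForm

open scoped Matrix

/-- An invertible `2 × 2` matrix with prescribed nonzero first row. [folklore] -/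
theorem exists_matrix_two_row_zero_eq {ν : Fin 2 → F} (hν : ν ≠ 0) :
    ∃ B : Matrix (Fin 2) (Fin 2) F, IsUnit B.det ∧ ∀ j, B 0 j = ν j := by
  obtain ⟨i, hi⟩ := Function.ne_iff.1 hν
  fin_cases i
  · refine ⟨!![ν 0, ν 1; 0, 1], ?_, fun j => by fin_cases j <;> rfl⟩
    refine isUnit_iff_ne_zero.2 ?_
    rw [Matrix.det_fin_two]
    simpa using hi
  · refine ⟨!![ν 0, ν 1; 1, 0], ?_, fun j => by fin_cases j <;> rfl⟩
    refine isUnit_iff_ne_zero.2 ?_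
    rw [Matrix.det_fin_two]
    simpa using hi

/-- **Vanishing on a line through the origin forces divisibility by its linear form** (the plane
version of `Literature.Combinatorics.Extremal.linearForm_dvd_of_eval_eq_zero`: change coordinates so
that the line is `z₀ = 0` and use `X_zero_dvd_of_eval_eq_zero`). [folklore] -/
theorem linearForm_dvd_of_eval_eq_zero_two [Infinite F] {ν : Fin 2 → F} (hν : ν ≠ 0)
    (f : MvPolynomial (Fin 2) F) (h : ∀ z : Fin 2 → F, ν ⬝ᵥ z = 0 → eval z f = 0) :
    (∑ j, C (ν j) * X j) ∣ f := by
  classical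
  obtain ⟨B, hB, hrow⟩ := exists_matrix_two_row_zero_eq hν
  -- `f' = f ∘ B⁻¹` vanishes on `y₀ = 0`
  set f' := aeval (fun i => ∑ j, C (B⁻¹ i j) * X j) f with hf'
  have hf'0 : ∀ z : Fin 1 → F, eval (Fin.cons 0 z) f' = 0 := by
    intro z
    rw [hf', eval_linSubst]
    refine h _ ?_
    have e : ν ⬝ᵥ (B⁻¹ *ᵥ (Fin.cons 0 z : Fin 2 → F)) =
        (B *ᵥ (B⁻¹ *ᵥ (Fin.cons 0 z : Fin 2 → F))) 0 := by
      simp only [Matrix.mulVec, dotProduct]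
      exact Finset.sum_congr rfl fun j _ => by rw [hrow j]
    rw [e, Matrix.mulVec_mulVec, Matrix.mul_nonsing_inv B hB, Matrix.one_mulVec]
    rfl
  obtain ⟨g, hg⟩ := X_zero_dvd_of_eval_eq_zero f' hf'0
  -- substitute back
  have hback : aeval (fun i => ∑ j, C (B i j) * X j) f' = f := by
    rw [hf', linSubst_linSubst, Matrix.nonsing_inv_mul B hB, linSubst_one]
  refine ⟨aeval (fun i => ∑ j, C (B i j) * X j) g, ?_⟩
  rw [← hback, hg, map_mul, aeval_X]
  congr 1
  exact Finset.sum_congr rfl fun j _ => by rw [hrow j]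

/-- The points `z` of the plane with `v₂ z₁ - v₁ z₂ = 0` are the multiples of `v ≠ 0`.
[folklore] -/
theorem perpForm_eq_zero_iff {v : Fin 2 → F} (hv : v ≠ 0) (z : Fin 2 → F) :
    v 1 * z 0 - v 0 * z 1 = 0 ↔ ∃ t : F, z = t • v := by
  constructor
  · intro hz
    by_cases h0 : v 0 = 0
    · have h1 : v 1 ≠ 0 := by
        intro h1
        apply hv
        funext i
        fin_cases i
        · exact h0
        · exact h1
      have hz0 : z 0 = 0 := by
        rw [h0, zero_mul, sub_zero] at hz
        exact (mul_eq_zero.1 hz).resolve_left h1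
      refine ⟨z 1 / v 1, ?_⟩
      funext i
      fin_cases i
      · simp [hz0, h0]
      · simp [div_mul_cancel₀ _ h1]
    · refine ⟨z 0 / v 0, ?_⟩
      funext i
      fin_cases i
      · simp [div_mul_cancel₀ _ h0]
      · simp only [Fin.mk_one, Fin.isValue, Pi.smul_apply, smul_eq_mul]
        rw [div_mul_eq_mul_div, eq_div_iff h0]
        linear_combination -hz
  · rintro ⟨t, rfl⟩
    simp only [Pi.smul_apply, smul_eq_mul]
    ring

end LinearForm

/-! ### Lines of rational slope (Mantova–Masser's (LRS)) -/

section RationalSlope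

/-- **Line of rational slope** [MantovaMasser2023, §1 display (LRS), p. 3]: the plane line
`{x | m₁ x₁ + m₂ x₂ = c}` with `c ∈ F` and integers `m₁, m₂` not both zero — the fourth case of
[MantovaMasser2023, Thm. 1.2] ("the Zariski closure of `π(S)` is a line of rational slope").
[cite: MantovaMasser2023, §1 (LRS), Thm. 1.2] -/
def IsRationalSlopeLine (S : Set (Fin 2 → F)) : Prop :=
  ∃ m : Fin 2 → ℤ, m ≠ 0 ∧ ∃ c : F, S = {x | (m 0 : F) * x 0 + (m 1 : F) * x 1 = c}

/-- A plane line is the zero locus of its affine linear equation. [folklore] -/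
theorem setOf_linear_eq_zeroLocus (a b c : F) :
    {x : Fin 2 → F | a * x 0 + b * x 1 = c} =
      zeroLocus F (Ideal.span {(C a * X 0 + C b * X 1 - C c : MvPolynomial (Fin 2) F)}) := by
  ext x
  simp only [Set.mem_setOf_eq, mem_zeroLocus_span_singleton_iff, map_sub, map_add, map_mul,
    aeval_X, aeval_C, Algebra.algebraMap_self_apply, sub_eq_zero]

/-- Lines of rational slope are Zariski closed. [folklore] -/
theorem IsRationalSlopeLine.isZariskiClosed {S : Set (Fin 2 → F)} (h : IsRationalSlopeLine S) :
    IsZariskiClosed F S := by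
  obtain ⟨m, -, c, rfl⟩ := h
  exact ⟨_, setOf_linear_eq_zeroLocus _ _ _⟩

/-- **(LRS) ⇒ periodic**: the integer vector `(m₂, -m₁)` is a period of the line
`m₁ x₁ + m₂ x₂ = c`. [folklore] -/
theorem IsRationalSlopeLine.hasIntegerPeriod {S : Set (Fin 2 → F)} (h : IsRationalSlopeLine S) :
    HasIntegerPeriod F S := by
  have hcl := h.isZariskiClosed
  obtain ⟨m, hm, c, rfl⟩ := h
  rw [hasIntegerPeriod_iff_forall_mem_zeroLocus]
  refine ⟨![m 1, -m 0], ?_, fun x hx => ?_⟩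
  · intro h0
    apply hm
    have h1 : m 1 = 0 := by simpa using congr_fun h0 0
    have h2 : m 0 = 0 := by simpa using congr_fun h0 1
    funext i
    fin_cases i
    · exact h2
    · exact h1
  · rw [mem_zeroLocus_vanishingIdeal_iff_of_isZariskiClosed hcl] at hx ⊢
    simp only [Set.mem_setOf_eq, Pi.add_apply, Matrix.cons_val_zero, Matrix.cons_val_one,
      Int.cast_neg] at hx ⊢
    linear_combination hx

/-- **Periodic ⇒ (LRS) for irreducible plane curves.** An irreducible Zariski closed `S ⊆ F²` of
dimension `1` (`char F = 0`) whose vanishing ideal has an integer period is a line of rational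
slope. [folklore] -/
theorem isRationalSlopeLine_of_hasIntegerPeriod [CharZero F] {S : Set (Fin 2 → F)}
    (hS : IsIrreducibleClosed F S) (hdim : zariskiDim F S = (1 : ℕ))
    (hper : HasIntegerPeriod F S) : IsRationalSlopeLine S := by
  classical
  -- the period line: `x + t v ∈ S` for all `x ∈ S`, `t ∈ F`
  obtain ⟨v, hv, hline⟩ := exists_forall_add_smul_mem_of_hasIntegerPeriod hper
  set v' : Fin 2 → F := fun i => (v i : F) with hv'
  have hv'ne : v' ≠ 0 := by
    intro h0
    apply hv
    funext i
    have := congr_fun h0 i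
    simp only [hv', Pi.zero_apply, Int.cast_eq_zero] at this
    exact this
  -- `I(S) = (h)` with `h` irreducible, and a point `p ∈ S`
  obtain ⟨h, hirr, hIS⟩ := exists_irreducible_vanishingIdeal_eq_span (d := 1) hS.2 hdim
  have hne : S.Nonempty := by
    by_contra hempty
    rw [Set.not_nonempty_iff_eq_empty] at hempty
    apply hS.2.ne_top
    rw [hempty]
    exact vanishingIdeal_empty
  obtain ⟨p, hp⟩ := hne
  have hlineS : ∀ t : F, p + t • v' ∈ S := fun t =>
    (mem_zeroLocus_vanishingIdeal_iff_of_isZariskiClosed hS.1 _).1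
      (hline t p ((mem_zeroLocus_vanishingIdeal_iff_of_isZariskiClosed hS.1 p).2 hp))
  have hhS : ∀ x ∈ S, eval x h = 0 := by
    intro x hx
    have hmem : h ∈ vanishingIdeal F S := by
      rw [hIS]
      exact Ideal.mem_span_singleton_self h
    -- `aeval x = eval x` on `F[X] → F`, definitionally
    exact (mem_vanishingIdeal_iff.1 hmem) x hx
  -- `h(X + p)` vanishes on the line `F v' = {ν ⬝ z = 0}`, `ν = (v'₁, -v'₀)`
  set ν : Fin 2 → F := ![v' 1, -v' 0] with hν
  have hνne : ν ≠ 0 := by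
    intro h0
    apply hv'ne
    have h1 : v' 1 = 0 := by simpa [hν] using congr_fun h0 0
    have h2 : v' 0 = 0 := by simpa [hν] using congr_fun h0 1
    funext i
    fin_cases i
    · exact h2
    · exact h1
  have hνdot : ∀ z : Fin 2 → F, ν ⬝ᵥ z = v' 1 * z 0 - v' 0 * z 1 := by
    intro z
    simp only [hν, dotProduct, Fin.sum_univ_two, Matrix.cons_val_zero, Matrix.cons_val_one]
    ring
  have hvan : ∀ z : Fin 2 → F, ν ⬝ᵥ z = 0 → eval z (transl p h) = 0 := by
    intro z hz
    rw [hνdot] at hz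
    obtain ⟨t, rfl⟩ := (perpForm_eq_zero_iff hv'ne z).1 hz
    rw [eval_transl, add_comm]
    exact hhS _ (hlineS t)
  have hdvd : (∑ j, C (ν j) * X j) ∣ transl p h :=
    linearForm_dvd_of_eval_eq_zero_two hνne _ hvan
  -- translating back: the affine linear form `ℓ` divides `h`
  set ℓ : MvPolynomial (Fin 2) F := transl (-p) (∑ j, C (ν j) * X j) with hℓ
  have hback : transl (-p) (transl p h) = h := by
    rw [← AlgHom.comp_apply, ← transl_add, neg_add_cancel, transl_zero, AlgHom.id_apply]
  have hℓdvd : ℓ ∣ h := by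
    have := map_dvd (transl (-p)) hdvd
    rwa [hback] at this
  have hℓeval : ∀ x : Fin 2 → F, eval x ℓ = v' 1 * (x 0 - p 0) - v' 0 * (x 1 - p 1) := by
    intro x
    rw [hℓ, eval_transl]
    simp only [hν, map_add, map_mul, map_neg, eval_C, eval_X, Fin.sum_univ_two,
      Matrix.cons_val_zero, Matrix.cons_val_one, Pi.add_apply, Pi.neg_apply]
    ring
  have hℓnu : ¬ IsUnit ℓ := by
    intro hu
    obtain ⟨r, hr, hℓr⟩ := MvPolynomial.isUnit_iff_eq_C_of_isReduced.1 hu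
    have := hℓeval p
    rw [hℓr, eval_C, sub_self, sub_self, mul_zero, mul_zero, sub_zero] at this
    exact hr.ne_zero this
  -- `h = ℓ · c` with `c ∈ Fˣ`
  obtain ⟨u, hu⟩ := hℓdvd
  have huu : IsUnit u := (hirr.isUnit_or_isUnit hu).resolve_left hℓnu
  obtain ⟨r, hr, hur⟩ := MvPolynomial.isUnit_iff_eq_C_of_isReduced.1 huu
  have hr0 : r ≠ 0 := hr.ne_zero
  -- `S = Z(h) = Z(ℓ)` is the line `v₂ x₁ - v₁ x₂ = v₂ p₁ - v₁ p₂`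
  refine ⟨![v 1, -v 0], ?_, v' 1 * p 0 - v' 0 * p 1, ?_⟩
  · intro h0
    apply hv
    have h1 : v 1 = 0 := by simpa using congr_fun h0 0
    have h2 : v 0 = 0 := by simpa using congr_fun h0 1
    funext i
    fin_cases i
    · exact h2
    · exact h1
  · ext x
    rw [← mem_zeroLocus_vanishingIdeal_iff_of_isZariskiClosed hS.1 x, hIS,
      mem_zeroLocus_span_singleton_iff]
    change eval x h = 0 ↔ _
    rw [hu, map_mul, hur, eval_C, mul_eq_zero, or_iff_left hr0, hℓeval, Set.mem_setOf_eq]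
    simp only [Matrix.cons_val_zero, Matrix.cons_val_one, Int.cast_neg, hv']
    constructor
    · intro e
      linear_combination e
    · intro e
      linear_combination e

/-- **Integer period ⟺ line of rational slope** for irreducible plane curves (`char F = 0`): the
typed notion `HasIntegerPeriod` of `EACAperiodicBase` and Mantova–Masser's (LRS) coincide in the
plane. [folklore] -/
theorem hasIntegerPeriod_iff_isRationalSlopeLine [CharZero F] {S : Set (Fin 2 → F)}
    (hS : IsIrreducibleClosed F S) (hdim : zariskiDim F S = (1 : ℕ)) :
    HasIntegerPeriod F S ↔ IsRationalSlopeLine S :=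
  ⟨isRationalSlopeLine_of_hasIntegerPeriod hS hdim, IsRationalSlopeLine.hasIntegerPeriod⟩

end RationalSlope

/-! ### The dictionary in cell `(2, 1)` -/

section CellTwoOne

/-- `I(cl T) = I(T)`: the vanishing ideal does not see the difference between a set and its Zariski
closure. [folklore] -/
theorem vanishingIdeal_zeroLocus_vanishingIdeal {ι : Type*} (T : Set (ι → F)) :
    vanishingIdeal F (zeroLocus F (vanishingIdeal F T)) = vanishingIdeal F T := by
  refine le_antisymm (vanishingIdeal_anti_mono fun x hx => ?_) (le_vanishingIdeal_zeroLocus _)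
  rw [mem_zeroLocus_iff]
  exact fun p hp => (mem_vanishingIdeal_iff.1 hp) x hx

/-- Integer periods are a property of the Zariski closure. [folklore] -/
theorem hasIntegerPeriod_zeroLocus_vanishingIdeal_iff {n : ℕ} (T : Set (Fin n → F)) :
    HasIntegerPeriod F (zeroLocus F (vanishingIdeal F T)) ↔ HasIntegerPeriod F T := by
  simp only [HasIntegerPeriod, vanishingIdeal_zeroLocus_vanishingIdeal]

/-- The Zariski dimension is that of the Zariski closure. [folklore] -/
theorem zariskiDim_zeroLocus_vanishingIdeal {ι : Type*} (T : Set (ι → F)) :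
    zariskiDim F (zeroLocus F (vanishingIdeal F T)) = zariskiDim F T := by
  unfold zariskiDim
  rw [vanishingIdeal_zeroLocus_vanishingIdeal]

/-- **Dictionary for cell `(2, 1)`.** For an irreducible `W ⊆ ℂ² × ℂ²` meeting `G²` with
`dim cl π(W ∩ G²) = 1`, the base `π(W ∩ G²)` has an integer period iff its Zariski closure is a
line of rational slope: the hypothesis of `ECCellPeriodic 1` is exactly the (LRS) case of
[MantovaMasser2023, Thm. 1.2], and that of `ECCellAperiodic 1` its case "`dim π(S) = 1` and the
closure of `π(S)` is not a line of rational slope". [cite: MantovaMasser2023, Thm. 1.2] -/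
theorem hasIntegerPeriod_projAdd_iff_isRationalSlopeLine {W : Set (Fin 2 ⊕ Fin 2 → ℂ)}
    (hW : IsIrreducibleClosed ℂ W) (hne : (W ∩ torusLocus ℂ 2).Nonempty)
    (hbase : addProjDim ℂ 2 W = (1 : ℕ)) :
    HasIntegerPeriod ℂ (projAdd '' (W ∩ torusLocus ℂ 2)) ↔
      IsRationalSlopeLine (zeroLocus ℂ (vanishingIdeal ℂ (projAdd '' (W ∩ torusLocus ℂ 2)))) := by
  set T := projAdd '' (W ∩ torusLocus ℂ 2) with hT
  have hprime : (vanishingIdeal ℂ T).IsPrime := by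
    haveI := hW.2
    have hWZ : W = zeroLocus ℂ (vanishingIdeal ℂ W) :=
      eq_zeroLocus_vanishingIdeal_of_isZariskiClosed hW.1
    have hIV : vanishingIdeal ℂ (W ∩ torusLocus ℂ 2) = vanishingIdeal ℂ W := by
      have hne' : (zeroLocus ℂ (vanishingIdeal ℂ W) ∩ torusLocus ℂ 2).Nonempty := by rwa [← hWZ]
      have := vanishingIdeal_zeroLocus_inter_torusLocus (vanishingIdeal ℂ W) hne'
      rwa [← hWZ] at this
    rw [hT, vanishingIdeal_image_projAdd, hIV]
    infer_instance
  have hcl : IsIrreducibleClosed ℂ (zeroLocus ℂ (vanishingIdeal ℂ T)) :=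
    ⟨isZariskiClosed_zeroLocus _, by rwa [vanishingIdeal_zeroLocus_vanishingIdeal]⟩
  have hdim : zariskiDim ℂ (zeroLocus ℂ (vanishingIdeal ℂ T)) = (1 : ℕ) := by
    rw [zariskiDim_zeroLocus_vanishingIdeal]
    exact hbase
  rw [← hasIntegerPeriod_zeroLocus_vanishingIdeal_iff]
  exact hasIntegerPeriod_iff_isRationalSlopeLine hcl hdim

end CellTwoOne

/-! ### Cell `(2, 1)`: the periodic sub-cell is vacuous -/

section PlaneCells

/-- If the Zariski closure of `π(S)` is a line of rational slope `{m₁ x₁ + m₂ x₂ = c}`, then (AF)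
holds on `S` with these `m ≠ 0` and `c`: `S` is not additively free (Mantova–Masser 2024 §1: in
case (LRS) "`S` is not free"). [cite: MantovaMasser2023, §1 (LRS), Thm. 1.2] -/
theorem not_isAddFree_of_isRationalSlopeLine {S : Set (Fin 2 ⊕ Fin 2 → ℂ)}
    (hL : IsRationalSlopeLine (zeroLocus ℂ (vanishingIdeal ℂ (projAdd '' S)))) :
    ¬ IsAddFree ℂ 2 S := by
  obtain ⟨m, hm, c, hc⟩ := hL
  intro hfree
  refine hfree m hm ⟨c, fun z hz => ?_⟩
  have hzL : projAdd z ∈ zeroLocus ℂ (vanishingIdeal ℂ (projAdd '' S)) :=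
    zeroLocus_vanishingIdeal_le _ (Set.mem_image_of_mem _ hz)
  rw [hc, Set.mem_setOf_eq, projAdd_apply, projAdd_apply] at hzL
  simpa [Fin.sum_univ_two] using hzL

/-- **In cell `(2, 1)` the periodic sub-cell is vacuous**: `ECCellPeriodic 1` holds because its
hypotheses are contradictory — by the dictionary `hasIntegerPeriod_projAdd_iff_isRationalSlopeLine`
an integer period of the one-dimensional base makes its closure a line of rational slope, on which
(AF) holds, contradicting additive freeness. So for `n = 2` periodicity of the base never occurs for
free `S`; Mantova–Masser's case (LRS) of Thm. 1.2 concerns NON-free surfaces.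
[cite: MantovaMasser2023, Thm. 1.2] -/
theorem ecCellPeriodic_one : ECCellPeriodic 1 := by
  intro W hW hne _hrot hadd _hmul _hdim hbase hper
  exact (not_isAddFree_of_isRationalSlopeLine
    ((hasIntegerPeriod_projAdd_iff_isRationalSlopeLine hW hne hbase).1 hper) hadd).elim

/-- Hence cell `(2, 1)` IS its aperiodic sub-cell: `ECCell 2 1 ↔ ECCellAperiodic 1`
(`EACAperiodicBase.ecCell_succ_iff` with the vacuous periodic half removed). In cell `(3, 2)` no such
collapse happens (`ecCellPeriodic_two_hypotheses_satisfiable`). [folklore] -/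
theorem ecCell_two_one_iff_ecCellAperiodic_one : ECCell 2 1 ↔ ECCellAperiodic 1 :=
  ⟨fun h => ecCellAperiodic_of_ecCell h,
    fun h => ecCell_of_aperiodic_of_periodic h ecCellPeriodic_one⟩

/-- **Contrast with cell `(3, 2)`**: there all eight hypotheses of the periodic sub-cell
`ECCellPeriodic 2` — irreducible, meets `G³`, rotund, additively free, multiplicatively free,
`dim = 3`, `addProjDim = 2`, base periodic — hold simultaneously, e.g. for the parabolic-cylinder
system of `EACSubcellCertificates` (`ecCellPeriodic_hypotheses_parabolicCylinderModel`; likewise the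
`√2`-hyperplane model). The periodic sub-rung is a phenomenon that first appears at `n = 3`.
[folklore] -/
theorem ecCellPeriodic_two_hypotheses_satisfiable :
    ∃ W : Set (Fin 3 ⊕ Fin 3 → ℂ), IsIrreducibleClosed ℂ W ∧ (W ∩ torusLocus ℂ 3).Nonempty ∧
      IsRotund ℂ 3 (W ∩ torusLocus ℂ 3) ∧ IsAddFree ℂ 3 (W ∩ torusLocus ℂ 3) ∧
      IsMulFree ℂ 3 (W ∩ torusLocus ℂ 3) ∧ zariskiDim ℂ W = (3 : ℕ) ∧
      addProjDim ℂ 3 W = (2 : ℕ) ∧ HasIntegerPeriod ℂ (projAdd '' (W ∩ torusLocus ℂ 3)) :=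
  ⟨parabolicCylinderModel, ecCellPeriodic_hypotheses_parabolicCylinderModel⟩

end PlaneCells

/-! ### Mantova–Masser 2024, Theorem 1.2, typed -/

section MantovaMasserTheoremTwo

/-- **Mantova–Masser 2024, Theorem 1.2, case "not a line of rational slope"** (PLMS 129 (2024)
e12627 = arXiv:2303.05592, Thm. 1.2 p. 4), typed verbatim: "Suppose `S` is an irreducible surface in
`ℂ² × ℂ*²`, and let `Z = Z_S` be the set of points (SZ) in `S`. … If `dim π(S) = 1` and the Zariski
closure of `π(S)` is not a line of rational slope, then `π(Z)` is infinite, so Zariski dense in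
`π(S)`." Here `S = W ∩ G²` for `W ⊆ ℂ² × ℂ²` irreducible Zariski closed of dimension `2` meeting
the torus `G²`, `π = projAdd`, `Z = W ∩ expGraph ℂ 2` (points `(z, e^z)` of `S`), "line of rational
slope" = `IsRationalSlopeLine` (display (LRS) p. 3). No freeness hypothesis of any kind. A theorem
PROVED in print (punctured Borel–Carathéodory, differentials on the curve, Ax's theorem), not yet
formalised: used below only as a hypothesis `(h : mantovaMasser2024_thm_1_2_notLRS)`.
[cite: MantovaMasser2023, Thm. 1.2] -/
def mantovaMasser2024_thm_1_2_notLRS : Prop :=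
  ∀ (W : Set (Fin 2 ⊕ Fin 2 → ℂ)), IsIrreducibleClosed ℂ W → (W ∩ torusLocus ℂ 2).Nonempty →
    zariskiDim ℂ W = (2 : ℕ) → addProjDim ℂ 2 W = (1 : ℕ) →
    ¬ IsRationalSlopeLine (zeroLocus ℂ (vanishingIdeal ℂ (projAdd '' (W ∩ torusLocus ℂ 2)))) →
    (projAdd '' (W ∩ expGraph ℂ 2)).Infinite

/-- Mantova–Masser's Thm. 1.2 (case not-(LRS)) gives the aperiodic sub-cell `ECCellAperiodic 1`:
by the dictionary, "no integer period" is "closure of `π(S)` not a line of rational slope", and an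
infinite `π(Z)` is in particular non-empty. (The freeness hypotheses of the cell are not used.)
[cite: MantovaMasser2023, Thm. 1.2] -/
theorem ecCellAperiodic_one_of_mantovaMasser_thm_1_2 (h : mantovaMasser2024_thm_1_2_notLRS) :
    ECCellAperiodic 1 := by
  intro W hW hne _hadd _hmul hdim hbase hper
  have hnl : ¬ IsRationalSlopeLine
      (zeroLocus ℂ (vanishingIdeal ℂ (projAdd '' (W ∩ torusLocus ℂ 2)))) := fun hL =>
    hper ((hasIntegerPeriod_projAdd_iff_isRationalSlopeLine hW hne hbase).2 hL)
  obtain ⟨_, z, hz, -⟩ := (h W hW hne hdim hbase hnl).nonempty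
  exact ⟨z, hz⟩

/-- Hence Mantova–Masser's Thm. 1.2 (case not-(LRS)) alone gives cell `(2, 1)`.
[cite: MantovaMasser2023, Thm. 1.2] -/
theorem ecCell_two_one_of_mantovaMasser_thm_1_2 (h : mantovaMasser2024_thm_1_2_notLRS) :
    ECCell 2 1 :=
  ecCell_two_one_iff_ecCellAperiodic_one.2 (ecCellAperiodic_one_of_mantovaMasser_thm_1_2 h)

/-- For comparison: Thm. 1.1 (any `n`, typed in `EAC`) also gives the aperiodic sub-cell
`ECCellAperiodic 1`, through `EACProofs.ecCell_one_right_of_mantovaMasser`.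
[cite: MantovaMasser2023, Thm. 1.1] -/
theorem ecCellAperiodic_one_of_mantovaMasser_thm_1_1 (h : mantovaMasser2024_thm_1_1) :
    ECCellAperiodic 1 :=
  ecCellAperiodic_of_ecCell (ecCell_one_right_of_mantovaMasser h 2)

/-- Mantova–Masser's `G = L × K`, `K = exp(L)` (display (GT), arXiv:2303.05592 p. 4), for any
`L ⊆ ℂⁿ`: the points `(z, ŷ) ∈ ℂⁿ × ℂⁿ` with `z ∈ L` and `ŷ = exp(z')` for some `z' ∈ L`. For `L` a
line of rational slope, `K` is a translate of a one-dimensional torus and `G` "a translate of a group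
subvariety" (loc. cit.). [cite: MantovaMasser2023, §1 (GT)] -/
def lineTimesExpImage {n : ℕ} (L : Set (Fin n → ℂ)) : Set (Fin n ⊕ Fin n → ℂ) :=
  {p | projAdd p ∈ L ∧ ∃ z ∈ L, ∀ j, p (Sum.inr j) = Complex.exp (z j)}

/-- Mantova–Masser's `L`: the Zariski closure of `π(S)`, `S = W ∩ Gⁿ`. [cite: MantovaMasser2023, §1 (LRS)] -/
def baseClosure {n : ℕ} (W : Set (Fin n ⊕ Fin n → ℂ)) : Set (Fin n → ℂ) :=
  zeroLocus ℂ (vanishingIdeal ℂ (projAdd '' (W ∩ torusLocus ℂ n)))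

/-- Mantova–Masser's `T = S ∩ G` (display (GT)), `S = W ∩ Gⁿ`, `G = L × exp(L)`, `L = cl π(S)`.
[cite: MantovaMasser2023, §1 (GT)] -/
def mmT {n : ℕ} (W : Set (Fin n ⊕ Fin n → ℂ)) : Set (Fin n ⊕ Fin n → ℂ) :=
  W ∩ torusLocus ℂ n ∩ lineTimesExpImage (baseClosure W)

/-- `Z ⊆ T`: every exponential point of `S = W ∩ Gⁿ` lies in `S ∩ (L × exp L)` for any
`L ⊇ π(S)`. [cite: MantovaMasser2023, §1 (GT)] -/
theorem inter_expGraph_subset_inter_lineTimesExpImage {n : ℕ} (W : Set (Fin n ⊕ Fin n → ℂ))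
    {L : Set (Fin n → ℂ)} (hL : projAdd '' (W ∩ torusLocus ℂ n) ⊆ L) :
    W ∩ expGraph ℂ n ⊆ W ∩ torusLocus ℂ n ∩ lineTimesExpImage L := by
  intro p hp
  have hpt : p ∈ W ∩ torusLocus ℂ n := ⟨hp.1, expGraph_subset_torusLocus hp.2⟩
  have hpL : projAdd p ∈ L := hL (Set.mem_image_of_mem _ hpt)
  exact ⟨hpt, hpL, projAdd p, hpL, fun j => (mem_expGraph_iff.1 hp.2) j⟩

/-- In particular `Z ⊆ T` for Mantova–Masser's `T`. [cite: MantovaMasser2023, §1 (GT)] -/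
theorem inter_expGraph_subset_mmT {n : ℕ} (W : Set (Fin n ⊕ Fin n → ℂ)) :
    W ∩ expGraph ℂ n ⊆ mmT W :=
  inter_expGraph_subset_inter_lineTimesExpImage W (zeroLocus_vanishingIdeal_le _)

/-- **Mantova–Masser 2024, Theorem 1.2, case (LRS), first sub-case — PROVED**: "If `T` is empty then
`π(Z)` is empty" (arXiv:2303.05592 p. 4; it needs neither (LRS) nor any hypothesis on `S`, since
`Z ⊆ T`). [cite: MantovaMasser2023, Thm. 1.2] -/
theorem mantovaMasser2024_thm_1_2_LRS_T_empty {n : ℕ} (W : Set (Fin n ⊕ Fin n → ℂ))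
    (hT : mmT W = ∅) : projAdd '' (W ∩ expGraph ℂ n) = ∅ := by
  rw [Set.image_eq_empty]
  exact Set.eq_empty_of_subset_empty (hT ▸ inter_expGraph_subset_mmT W)

/-- **Mantova–Masser 2024, Theorem 1.2, case (LRS), remaining sub-cases** (arXiv:2303.05592 p. 4),
typed verbatim: for `S` an irreducible surface in `ℂ² × ℂ*²` with `dim π(S) = 1` whose closure
`L = cl π(S)` IS a line of rational slope, and `T = S ∩ (L × exp L)`: "If `dim T = 2` then `π(Z)` is
infinite"; "If `dim T = 1` [and] `dim π(T) = 0` then `π(Z)` is non-empty and finite"; "If `dim T = 1`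
[and] `dim π(T) = 1` then `π(Z)` is infinite." (`dim` = `zariskiDim`, the dimension of the Zariski
closure; the sub-case `T = ∅` is the theorem `mantovaMasser2024_thm_1_2_LRS_T_empty`.) Together with
`mantovaMasser2024_thm_1_2_notLRS` this is the whole of Thm. 1.2 for `dim π(S) = 1`; the paper
stresses that "all possible cases and subcases may happen", the only one without points (SZ) being
`T = ∅` (typical example (NZ) p. 3: `X₁ + X₂ = 1`, `X̂₁X̂₂ = 1`, where `K` is `X̂₁X̂₂ = e`, so `T = ∅`).
PROVED in print, not formalised: a hypothesis only. [cite: MantovaMasser2023, Thm. 1.2] -/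
def mantovaMasser2024_thm_1_2_LRS : Prop :=
  ∀ (W : Set (Fin 2 ⊕ Fin 2 → ℂ)), IsIrreducibleClosed ℂ W → (W ∩ torusLocus ℂ 2).Nonempty →
    zariskiDim ℂ W = (2 : ℕ) → addProjDim ℂ 2 W = (1 : ℕ) → IsRationalSlopeLine (baseClosure W) →
    (zariskiDim ℂ (mmT W) = (2 : ℕ) → (projAdd '' (W ∩ expGraph ℂ 2)).Infinite) ∧
    (zariskiDim ℂ (mmT W) = (1 : ℕ) → zariskiDim ℂ (projAdd '' mmT W) = (0 : ℕ) →
      (projAdd '' (W ∩ expGraph ℂ 2)).Nonempty ∧ (projAdd '' (W ∩ expGraph ℂ 2)).Finite) ∧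
    (zariskiDim ℂ (mmT W) = (1 : ℕ) → zariskiDim ℂ (projAdd '' mmT W) = (1 : ℕ) →
      (projAdd '' (W ∩ expGraph ℂ 2)).Infinite)

/-- Under Thm. 1.2 (both cases) the census of cell-`(2,1)`-shaped surfaces is complete: for `W`
irreducible of dimension `2` meeting `G²` with one-dimensional base, exponential points exist unless
the base closure is a line of rational slope with `T = ∅` or … — in particular they exist whenever
`T` has dimension `2`, or dimension `1`. [cite: MantovaMasser2023, Thm. 1.2] -/
theorem inter_expGraph_nonempty_of_mantovaMasser_thm_1_2 (h₁ : mantovaMasser2024_thm_1_2_notLRS)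
    (h₂ : mantovaMasser2024_thm_1_2_LRS) {W : Set (Fin 2 ⊕ Fin 2 → ℂ)} (hW : IsIrreducibleClosed ℂ W)
    (hne : (W ∩ torusLocus ℂ 2).Nonempty) (hdim : zariskiDim ℂ W = (2 : ℕ))
    (hbase : addProjDim ℂ 2 W = (1 : ℕ))
    (hT : ¬ IsRationalSlopeLine (baseClosure W) ∨ zariskiDim ℂ (mmT W) = (2 : ℕ) ∨
      (zariskiDim ℂ (mmT W) = (1 : ℕ) ∧ (zariskiDim ℂ (projAdd '' mmT W) = (0 : ℕ) ∨
        zariskiDim ℂ (projAdd '' mmT W) = (1 : ℕ)))) :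
    (W ∩ expGraph ℂ 2).Nonempty := by
  have key : (projAdd '' (W ∩ expGraph ℂ 2)).Nonempty := by
    rcases hT with hnl | hT2 | ⟨hT1, hπ0 | hπ1⟩
    · exact (h₁ W hW hne hdim hbase hnl).nonempty
    · by_cases hL : IsRationalSlopeLine (baseClosure W)
      · exact ((h₂ W hW hne hdim hbase hL).1 hT2).nonempty
      · exact (h₁ W hW hne hdim hbase hL).nonempty
    · by_cases hL : IsRationalSlopeLine (baseClosure W)
      · exact ((h₂ W hW hne hdim hbase hL).2.1 hT1 hπ0).1
      · exact (h₁ W hW hne hdim hbase hL).nonempty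
    · by_cases hL : IsRationalSlopeLine (baseClosure W)
      · exact ((h₂ W hW hne hdim hbase hL).2.2 hT1 hπ1).nonempty
      · exact (h₁ W hW hne hdim hbase hL).nonempty
  obtain ⟨_, z, hz, -⟩ := key
  exact ⟨z, hz⟩

end MantovaMasserTheoremTwo

end Literature.ModelTheory.Zilber
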